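import Summits.QuantumFields.BalabanUV.Beta.GAN24.OneStepConstraintLocalisation
import Summits.QuantumFields.BalabanUV.T4Continuum.Support.CTKingTowerWeights

/-!
# `BalabanUV.Beta.GAN24.OneStepConstraintTowerReading` — binder row G-an2-4 ∕ (CONV-C), routes C-R6° («VALUES») × R7 («TWO CURRENCIES»), PART 171:
# PARTs 168–170 READ ON THE LINEAGE's TOWER INDEX (census V197, option (ii)): the one-step constraint `QBlev L M 0 = QB (lev L 0) L M` (by `rfl`) between the
# level-1 lattice `idx L M 1` and the unit lattice `idx L M 0`, its block parent `prtQ L M 0`, and the lineage's unit-lattice distance `distK L M` — the bridge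
# `distK x y = tdist x.1 y.1` (`tdist (toM x) (toM y) = tdist x y`), so that PART 170's three ENDs are statements in the INPUT-triple currency's distance `distK`
# (unit b2b-balaban-gan24-p3, gen 58; v1)

NOT IN PRINT; OUR PROOF ([folklore] bookkeeping BY NAME: `ZMod.natCast_zmod_val` under the modulus identity `lev L 0 · M_ν = M_ν`; leaf-06's `CTKingTowerWeights.distK ∕ toM`, the NE2 lineage's
`BlockSumDecay.prtQ`, `BalabanAveragedTowerUnit.QBlev ∕ idx`, and PART 170 `OneStepConstraintLocalisation` (`abs_effForm_le_QB`, `abs_minOp_le_QB`, `abs_flucCov_le_QB`), PART 168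
`tdist_par_le_one_of_QB_ne_zero`.  [Balaban1984PropagatorsI] (1.11) p. 19, (1.18) p. 20 LOCATE the averaging; nothing printed is a hypothesis.)
HONEST FRAMING (cell contract, verbatim): «discharging `BetaPertH` makes Bałaban's UV stability UNCONDITIONAL — a real constructive-QFT result; it is NOT the continuum limit
and NOT the Clay problem.»  HONEST DEPENDENCY (verbatim): «continuum YM on T⁴ ⇐ BetaPertH ∧ nine spine estimates (0/9 proved); BetaPertH ⇐ (D1) ∧ (D4) ∧ CAP+tail; G-an2-4 gates
asym, D1 and NE2/3/4.»

WHY.  PARTs 168–170 are stated for `QB N R M` with the torus sup-distance `VectorTailsCov.tdist` on `Tor (fine N M)`; the lineage's INPUT-triple currency (PARTs 127–160: `EntryDecay (distK L M)`,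
`UnitLatticeDecayAlgebra.sum_exp_distK_le`, the `ℤ^d` windows) measures unit-lattice kernels with `CTKingTowerWeights.distK L M x y = tdist (toM x.1) (toM y.1)` — the same number read
in `Tor M` instead of `Tor (fine (lev L 0) M)` (moduli `1·M_ν` and `M_ν`: equal, not definitionally).  THIS FILE proves the one-line bridge and restates PART 170's ENDs for census V197's
option (ii) data (`N = lev L 0`, `R = L`: fine = `idx L M 1`, coarse = `idx L M 0`, `Q̃ = re (QBlev L M 0)`, block parent `prtQ L M 0`) with every distance a `distK`.

WHAT THIS FILE PROVES (0 sorry, 0 `def`; `L ≥ 1`, every torus `M`, every `d`):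
* §1 `valMinAbs_natCast_val_sub` (casting along equal moduli preserves `valMinAbs` of differences), **`tdist_toM`** (`tdist (toM x) (toM y) = tdist x y`), **`distK_eq_tdist`**
  (`distK L M x y = tdist x.1 y.1`), `prtQ_zero_apply` (`prtQ L M 0 x = (par (lev L 0) L M x.1, x.2)`), **`distK_prtQ_le_one_of_QBlev_ne_zero`** (`QBlev L M 0 i x ≠ 0 ⟹ distK i (prtQ 0 x) ≤ 1`).
* §2 PART 170's ENDs in `distK`: **`abs_effForm_le_QBlev`** (`|𝒮(b,b′)| ≤ (2(Λ+a)+a)·e^{−r_U·distK(b,b′)}`), **`abs_minOp_le_QBlev`** (`|ℋ(x,b)| ≤ …·e^{−(m∕2)·distK(prtQ 0 x, b)}`),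
  **`abs_flucCov_le_QBlev`** (`|𝒢(x,x′)| ≤ …·e^{−min r_F (m∕4)·distK(prtQ 0 x, prtQ 0 x′)}`) — same hypotheses on the fine form `H` on `idx L M 1` (entry decay now in `distK ∘ prtQ 0`) and the
  same site profile `Kf` (`Σ_{y′} e^{−s·tdist(y,y′)} ≤ Kf s` on `Tor (fine (lev L 0) M)`; `UnitLatticeDecayAlgebra.sum_exp_distK_le`'s source `sum_exp_tdist_le` supplies it for `d ≥ 2`).
WHAT IT IS NOT: a choice of option (ii) over (i) (that is the OWNER's ∕ planners', census V197) — it only shows option (ii) is cast-free down to the distance; no model-side letter.  SUPPLIER work;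
NEVER «G-an2-4 closed»; NOT (CONV-C), NOT D1, NOT `BetaPertH`, NOT continuum, NOT Clay.  Records: `HOME/b2b-balaban-gan24-p3/gen58/README.md`.
-/

noncomputable section

open scoped BigOperators Matrix
open Finset Matrix

namespace Summit.QuantumFields.BalabanUV.Beta.GAN24.OneStepConstraintTowerReading

open Literature.MathematicalPhysics.QuantumFieldTheory.Balaban1983to89
open Literature.MathematicalPhysics.QuantumFieldTheory.Balaban1983to89.B4Sect5Torus (rate)
open Literature.MathematicalPhysics.QuantumFieldTheory.Balaban1983to89.Beta.CompositionSingular (effForm minOp flucCov)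
open Literature.MathematicalPhysics.QuantumFieldTheory.Balaban1983to89.B5Prop11Plancherel (Tor fine)
open Literature.MathematicalPhysics.QuantumFieldTheory.Balaban1983to89.B5G183RateUnitTower (lev)
open Literature.MathematicalPhysics.QuantumFieldTheory.Balaban1983to89.B5RealFields (reM)
open Literature.MathematicalPhysics.QuantumFieldTheory.Balaban1983to89.Beta.VectorTails (liftZ)
open Literature.MathematicalPhysics.QuantumFieldTheory.Balaban1983to89.Beta.VectorTailsCov (tdist)
open Summit.QuantumFields.BalabanUV.T4Continuum.BalabanLineAverage (QB)
open Summit.QuantumFields.BalabanUV.T4Continuum.BalabanAveragedTowerUnit (idx QBlev)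
open Summit.QuantumFields.BalabanUV.T4Continuum.BalabanAveragedTowerModes (par)
open Summit.QuantumFields.BalabanUV.T4Continuum.BlockSumDecay (prtQ)
open Summit.QuantumFields.BalabanUV.T4Continuum.CTKingTowerWeights (toM distK)
open Summit.QuantumFields.BalabanUV.Beta.GAN24.OneStepConstraintLetters (tdist_par_le_one_of_QB_ne_zero)
open Summit.QuantumFields.BalabanUV.Beta.GAN24.OneStepConstraintLocalisation (abs_effForm_le_QB abs_minOp_le_QB abs_flucCov_le_QB)

variable {d : ℕ} (L : ℕ) [NeZero L] (M : Fin d → ℕ) [hM : ∀ μ, NeZero (M μ)]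

/-! ## §1 The bridge `distK = tdist` and the level-0 readings -/

section Bridge

omit hM in
/-- casting the VALUES of two residues along EQUAL moduli preserves the centred lift of their difference. [folklore] -/
theorem valMinAbs_natCast_val_sub {n m : ℕ} [NeZero n] (h : n = m) (a b : ZMod n) :
    (((a.val : ℕ) : ZMod m) - ((b.val : ℕ) : ZMod m)).valMinAbs = (a - b).valMinAbs := by
  subst h
  rw [ZMod.natCast_zmod_val, ZMod.natCast_zmod_val]

/-- **`tdist_toM`**: reading unit-lattice sites in `Tor M` (leaf-06's `toM`, same values) does not change the torus sup-distance: `tdist (toM x) (toM y) = tdist x y`. [folklore] -/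
theorem tdist_toM (x y : Tor (fine (lev L 0) M)) : tdist (toM L M x) (toM L M y) = tdist x y := by
  have hmod : ∀ ν : Fin d, fine (lev L 0) M ν = M ν := fun ν => by show lev L 0 * M ν = M ν; rw [show lev L 0 = 1 from rfl, one_mul]
  have hlift : liftZ (toM L M y - toM L M x) = liftZ (y - x) := by
    funext ν
    simp only [liftZ, Pi.sub_apply, toM]
    exact valMinAbs_natCast_val_sub (hmod ν) (y ν) (x ν)
  show Beta.PoissonInterior.supNorm (liftZ (toM L M y - toM L M x)) = Beta.PoissonInterior.supNorm (liftZ (y - x))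
  rw [hlift]

/-- **`distK_eq_tdist`**: the lineage's unit-lattice distance IS the torus sup-distance of the sites: `distK L M x y = tdist x.1 y.1`. [folklore] -/
theorem distK_eq_tdist (x y : idx L M 0) : distK L M x y = (tdist x.1 y.1 : ℝ) := by
  unfold distK
  rw [tdist_toM]

omit [NeZero L] hM in
/-- the one-step block parent at level `0` is `par` on sites (definitional). [folklore] -/
theorem prtQ_zero_apply (x : idx L M 1) : prtQ L M 0 x = (par (lev L 0) L M x.1, x.2) := rfl

/-- the one-step constraint at level `0` is `QB (lev L 0) L M` (definitional). [folklore] -/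
theorem QBlev_zero : QBlev L M 0 = QB (lev L 0) L M := rfl

/-- **the block support of `QBlev L M 0` in the lineage's distance**: `QBlev L M 0 i x ≠ 0 ⟹ distK(i, prtQ L M 0 x) ≤ 1`. [folklore] -/
theorem distK_prtQ_le_one_of_QBlev_ne_zero {i : idx L M 0} {x : idx L M 1} (h : QBlev L M 0 i x ≠ 0) : distK L M i (prtQ L M 0 x) ≤ 1 := by
  rw [distK_eq_tdist, prtQ_zero_apply]
  exact_mod_cast tdist_par_le_one_of_QB_ne_zero (lev L 0) L M h

end Bridge

/-! ## §2 PART 170's ENDs for option (ii)'s data, every distance a `distK` -/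

section Ends

variable {H : Matrix (idx L M 1) (idx L M 1) ℝ} {Kf : ℝ → ℝ}

/-- **`abs_effForm_le_QBlev`** — PART 170 `abs_effForm_le_QB` at `N = lev L 0`, `R = L`, read in `distK`: `|𝒮(b,b′)| ≤ (2(Λ+a)+a)·e^{−r_U·distK(b,b′)}`. [folklore] -/
theorem abs_effForm_le_QBlev (hKf0 : ∀ s : ℝ, 0 < s → 0 ≤ Kf s)
    (hKf : ∀ s : ℝ, 0 < s → ∀ y : Tor (fine (lev L 0) M), ∑ y' : Tor (fine (lev L 0) M), Real.exp (-(s * (tdist y y' : ℝ))) ≤ Kf s)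
    (hH : Hᵀ = H) (hpsd : ∀ z, 0 ≤ z ⬝ᵥ (H *ᵥ z)) {h : ℝ} (hh : 0 ≤ h) (hHub : ∀ u, u ⬝ᵥ (H *ᵥ u) ≤ h * (u ⬝ᵥ u)) {γ₀ : ℝ} (hγ₀ : 0 < γ₀)
    (hker : ∀ z, reM (QBlev L M 0) *ᵥ z = 0 → γ₀ * (z ⬝ᵥ z) ≤ z ⬝ᵥ (H *ᵥ z)) {a h₀ δH : ℝ} (ha : 0 < a) (hh₀ : 0 ≤ h₀) (hδH : 0 < δH)
    (hHent : ∀ x x', |H x x'| ≤ h₀ * Real.exp (-(δH * distK L M (prtQ L M 0 x) (prtQ L M 0 x'))))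
    {γK cK rF c₀ Λ rU : ℝ} (hγK : γK = (max (4 / γ₀) ((4 * h * ((L : ℝ) ^ d) ^ 2 / γ₀ + 2 * ((L : ℝ) ^ d) ^ 2) / a))⁻¹)
    (hcK : cK = h₀ + a * (((L : ℝ) ^ d)⁻¹ * ((L : ℝ) ^ d)⁻¹) * Real.exp (2 * δH)) (hrF : rF = rate (fun s => (d : ℝ) * (L : ℝ) ^ d * Kf s) γK cK δH)
    (hc₀ : c₀ = 2 / γK * Real.exp (2 * rF)) (hΛ : Λ = h * ((L : ℝ) ^ d) ^ 2) (hrU : rU = rate (fun s => (d : ℝ) * Kf s) (Λ + a)⁻¹ c₀ rF)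
    (b b' : idx L M 0) :
    |effForm H (reM (QBlev L M 0)) b b'| ≤ (2 * (Λ + a) + a) * Real.exp (-(rU * distK L M b b')) := by
  simp only [distK_eq_tdist, prtQ_zero_apply] at hHent ⊢
  exact abs_effForm_le_QB (lev L 0) L M hKf0 hKf hH hpsd hh hHub hγ₀ hker ha hh₀ hδH hHent hγK hcK hrF hc₀ hΛ hrU b b'

/-- **`abs_minOp_le_QBlev`** — PART 170 `abs_minOp_le_QB` read in `distK`: `|ℋ(x,b)| ≤ 2(Λ+a)·c₁·(d·Kf(m∕2))·e^{−(m∕2)·distK(prtQ L M 0 x, b)}`. [folklore] -/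
theorem abs_minOp_le_QBlev (hKf0 : ∀ s : ℝ, 0 < s → 0 ≤ Kf s)
    (hKf : ∀ s : ℝ, 0 < s → ∀ y : Tor (fine (lev L 0) M), ∑ y' : Tor (fine (lev L 0) M), Real.exp (-(s * (tdist y y' : ℝ))) ≤ Kf s)
    (hH : Hᵀ = H) (hpsd : ∀ z, 0 ≤ z ⬝ᵥ (H *ᵥ z)) {h : ℝ} (hh : 0 ≤ h) (hHub : ∀ u, u ⬝ᵥ (H *ᵥ u) ≤ h * (u ⬝ᵥ u)) {γ₀ : ℝ} (hγ₀ : 0 < γ₀)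
    (hker : ∀ z, reM (QBlev L M 0) *ᵥ z = 0 → γ₀ * (z ⬝ᵥ z) ≤ z ⬝ᵥ (H *ᵥ z)) {a h₀ δH : ℝ} (ha : 0 < a) (hh₀ : 0 ≤ h₀) (hδH : 0 < δH)
    (hHent : ∀ x x', |H x x'| ≤ h₀ * Real.exp (-(δH * distK L M (prtQ L M 0 x) (prtQ L M 0 x'))))
    {γK cK rF c₀ c₁ Λ rU m : ℝ} (hγK : γK = (max (4 / γ₀) ((4 * h * ((L : ℝ) ^ d) ^ 2 / γ₀ + 2 * ((L : ℝ) ^ d) ^ 2) / a))⁻¹)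
    (hcK : cK = h₀ + a * (((L : ℝ) ^ d)⁻¹ * ((L : ℝ) ^ d)⁻¹) * Real.exp (2 * δH)) (hrF : rF = rate (fun s => (d : ℝ) * (L : ℝ) ^ d * Kf s) γK cK δH)
    (hc₀ : c₀ = 2 / γK * Real.exp (2 * rF)) (hc₁ : c₁ = 2 / γK * Real.exp rF) (hΛ : Λ = h * ((L : ℝ) ^ d) ^ 2)
    (hrU : rU = rate (fun s => (d : ℝ) * Kf s) (Λ + a)⁻¹ c₀ rF) (hm : m = min rF rU) (x : idx L M 1) (b : idx L M 0) :
    |minOp H (reM (QBlev L M 0)) x b| ≤ 2 * (Λ + a) * c₁ * ((d : ℝ) * Kf (m / 2)) * Real.exp (-(m / 2 * distK L M (prtQ L M 0 x) b)) := by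
  simp only [distK_eq_tdist, prtQ_zero_apply] at hHent ⊢
  exact abs_minOp_le_QB (lev L 0) L M hKf0 hKf hH hpsd hh hHub hγ₀ hker ha hh₀ hδH hHent hγK hcK hrF hc₀ hc₁ hΛ hrU hm x b

/-- **`abs_flucCov_le_QBlev`** — PART 170 `abs_flucCov_le_QB` read in `distK`: the one-loop letter `𝒢 = flucCov H (re QBlev L M 0)` decays in the block distance,
`|𝒢(x,x′)| ≤ (2∕γ_K + 2(Λ+a)·c₁²·(d·Kf(m∕2))·(d·Kf(m∕4)))·e^{−min r_F (m∕4)·distK(prtQ L M 0 x, prtQ L M 0 x′)}`. [folklore] -/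
theorem abs_flucCov_le_QBlev (hKf0 : ∀ s : ℝ, 0 < s → 0 ≤ Kf s)
    (hKf : ∀ s : ℝ, 0 < s → ∀ y : Tor (fine (lev L 0) M), ∑ y' : Tor (fine (lev L 0) M), Real.exp (-(s * (tdist y y' : ℝ))) ≤ Kf s)
    (hH : Hᵀ = H) (hpsd : ∀ z, 0 ≤ z ⬝ᵥ (H *ᵥ z)) {h : ℝ} (hh : 0 ≤ h) (hHub : ∀ u, u ⬝ᵥ (H *ᵥ u) ≤ h * (u ⬝ᵥ u)) {γ₀ : ℝ} (hγ₀ : 0 < γ₀)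
    (hker : ∀ z, reM (QBlev L M 0) *ᵥ z = 0 → γ₀ * (z ⬝ᵥ z) ≤ z ⬝ᵥ (H *ᵥ z)) {a h₀ δH : ℝ} (ha : 0 < a) (hh₀ : 0 ≤ h₀) (hδH : 0 < δH)
    (hHent : ∀ x x', |H x x'| ≤ h₀ * Real.exp (-(δH * distK L M (prtQ L M 0 x) (prtQ L M 0 x'))))
    {γK cK rF c₀ c₁ Λ rU m : ℝ} (hγK : γK = (max (4 / γ₀) ((4 * h * ((L : ℝ) ^ d) ^ 2 / γ₀ + 2 * ((L : ℝ) ^ d) ^ 2) / a))⁻¹)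
    (hcK : cK = h₀ + a * (((L : ℝ) ^ d)⁻¹ * ((L : ℝ) ^ d)⁻¹) * Real.exp (2 * δH)) (hrF : rF = rate (fun s => (d : ℝ) * (L : ℝ) ^ d * Kf s) γK cK δH)
    (hc₀ : c₀ = 2 / γK * Real.exp (2 * rF)) (hc₁ : c₁ = 2 / γK * Real.exp rF) (hΛ : Λ = h * ((L : ℝ) ^ d) ^ 2)
    (hrU : rU = rate (fun s => (d : ℝ) * Kf s) (Λ + a)⁻¹ c₀ rF) (hm : m = min rF rU) (x x' : idx L M 1) :
    |flucCov H (reM (QBlev L M 0)) x x'| ≤ (2 / γK + 2 * (Λ + a) * c₁ ^ 2 * ((d : ℝ) * Kf (m / 2)) * ((d : ℝ) * Kf (m / 4))) *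
      Real.exp (-(min rF (m / 4) * distK L M (prtQ L M 0 x) (prtQ L M 0 x'))) := by
  simp only [distK_eq_tdist, prtQ_zero_apply] at hHent ⊢
  exact abs_flucCov_le_QB (lev L 0) L M hKf0 hKf hH hpsd hh hHub hγ₀ hker ha hh₀ hδH hHent hγK hcK hrF hc₀ hc₁ hΛ hrU hm x x'

end Ends

end Summit.QuantumFields.BalabanUV.Beta.GAN24.OneStepConstraintTowerReading

end
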